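import Mathlib.AlgebraicGeometry.ProjectiveSpectrum.Functor
import Mathlib.AlgebraicGeometry.IdealSheaf.Basic
import Literature.RingTheory.GradedAlgebra.QuotientGrading
import Literature.AlgebraicGeometry.FundamentalGroup.HyperplanePencil
import HarnessLib

/-!
# The ideal sheaf on `Proj A` of a homogeneous ideal: sections over the charts `D₊(s)`

Topic: `Literature/AlgebraicGeometry/Resolution` (input of the globalization step of Kawasaki's
Macaulayfication, Kawasaki 2000, §5: the centre `∏ᵢ (zᵢ,…,z_d)𝒪_X` of the Cohen–Macaulay blow-up is
built from ideal sheaves of homogeneous forms).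

For a graded ring `A = ⨁ 𝒜ᵢ`, a homogeneous `s ∈ 𝒜_d` and an ideal `I ≤ A`, the **degree-zero
part of `I_s`** is the ideal `awayIdeal 𝒜 hs I ≤ (A_s)₀ = Away 𝒜 s` spanned by the fractions
`a/sⁿ`, `a ∈ I ∩ 𝒜_{nd}` (Hartshorne II §5, before Prop. 5.11: `Ĩ(D₊(s)) = I_{(s)}`).

* `ker_awayMap_eq` — for a graded ring homomorphism `g : A → B`, the kernel of
  `(A_s)₀ → (B_{g s})₀` (Mathlib `HomogeneousLocalization.Away.map`) is `awayIdeal (ker g)`;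
* `ker_projMap_ideal_basicOpen` — for a SURJECTIVE graded `g` (so that `Proj g : Proj B → Proj A`
  is a closed immersion, `isClosedImmersion_projMap_of_surjective`), the kernel ideal sheaf of
  `Proj g` has sections `awayIdeal (ker g)` over `D₊(s)` (through Mathlib's
  `Γ(Proj A, D₊(s)) ≅ (A_s)₀`, `Proj.awayToSection` / `Proj.awayToSection_comp_appLE`);
* `projIdealSheaf 𝒜 I` — **the ideal sheaf `Ĩ` of a homogeneous ideal `I`**, defined as the kernel
  of the closed immersion `Proj (A ⧸ I) → Proj A` (`Literature.RingTheory.GradedAlgebra.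
  QuotientGrading`), with `projIdealSheaf_ideal_basicOpen : Ĩ(D₊(s)) = I_{(s)}`
  (Hartshorne II Prop. 5.9 / proof of 5.11 (b));
* `awayIdeal_span_le`, `awayIdeal_span_eq` — over a chart `D₊(s)` with `deg s = 1`, the ideal
  `I_{(s)}` of an ideal `I = (z_l)_l` generated by forms is generated by the dehomogenized forms
  `z_l / s^{deg z_l}`.

Everything is proved; no named facts.

## References

* R. Hartshorne, *Algebraic Geometry*, GTM 52 (1977): II Prop. 5.9, Prop. 5.11, Ex. 3.12.
  [Hartshorne1977]
* T. Kawasaki, *On Macaulayfication of Noetherian schemes*, Trans. AMS 352 (2000), §5. [Kawasaki2000]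
-/

noncomputable section

open CategoryTheory AlgebraicGeometry HomogeneousLocalization TopologicalSpace

universe u

namespace Literature.AlgebraicGeometry.Resolution

/-! ## The degree-zero part `I_{(s)}` of an ideal -/

section Algebra

variable {A σ : Type u} [CommRing A] [SetLike σ A] [AddSubgroupClass σ A]
  (𝒜 : ℕ → σ) [GradedRing 𝒜] {s : A} {d : ℕ} (hs : s ∈ 𝒜 d)

/-- The generating fractions `a/sⁿ`, `a ∈ I` homogeneous of degree `n · deg s`. [folklore] -/
def awayGens (I : Ideal A) : Set (Away 𝒜 s) :=
  {x | ∃ (n : ℕ) (a : A) (ha : a ∈ 𝒜 (n • d)), a ∈ I ∧ Away.mk 𝒜 hs n a ha = x}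

/-- **The degree-zero part `I_{(s)} ≤ (A_s)₀` of an ideal `I ≤ A`**: the ideal spanned by the
fractions `a/sⁿ` with `a ∈ I` homogeneous of degree `n · deg s`.
[cite: Hartshorne1977, II Prop. 5.11 (proof)] -/
def awayIdeal (I : Ideal A) : Ideal (Away 𝒜 s) :=
  Ideal.span (awayGens 𝒜 hs I)

/-- The generating fractions lie in `I_{(s)}`. [folklore] -/
theorem mk_mem_awayIdeal {I : Ideal A} {n : ℕ} {a : A} (ha : a ∈ 𝒜 (n • d)) (haI : a ∈ I) :
    Away.mk 𝒜 hs n a ha ∈ awayIdeal 𝒜 hs I :=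
  Ideal.subset_span ⟨n, a, ha, haI, rfl⟩

/-- `I_{(s)}` is monotone in `I`. [folklore] -/
theorem awayIdeal_mono {I J : Ideal A} (h : I ≤ J) : awayIdeal 𝒜 hs I ≤ awayIdeal 𝒜 hs J :=
  Ideal.span_mono fun _ ⟨n, a, ha, haI, hx⟩ => ⟨n, a, ha, h haI, hx⟩

/-- `a/sⁿ = (sᵐ a)/s^{m+n}`. [folklore] -/
theorem Away.mk_eq_mk_pow_mul (n m : ℕ) (a : A) (ha : a ∈ 𝒜 (n • d)) :
    Away.mk 𝒜 hs n a ha = Away.mk 𝒜 hs (m + n) (s ^ m * a)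
      (by rw [add_smul]; exact SetLike.mul_mem_graded (SetLike.pow_mem_graded m hs) ha) := by
  apply val_injective
  simp only [Away.val_mk]
  rw [Localization.mk_eq_mk_iff]
  refine Localization.r_of_eq ?_
  simp only [pow_add]
  ring

/-- A fraction `a/sⁿ` vanishes in `(A_s)₀` iff `sᵐ a = 0` for some `m`. [folklore] -/
theorem Away.mk_eq_zero_iff (n : ℕ) (a : A) (ha : a ∈ 𝒜 (n • d)) :
    Away.mk 𝒜 hs n a ha = 0 ↔ ∃ m : ℕ, s ^ m * a = 0 := by
  rw [HomogeneousLocalization.ext_iff_val, Away.val_mk, HomogeneousLocalization.val_zero,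
    Localization.mk_eq_mk'_apply, IsLocalization.mk'_eq_zero_iff]
  constructor
  · rintro ⟨⟨_, m, rfl⟩, hm⟩
    exact ⟨m, hm⟩
  · rintro ⟨m, hm⟩
    exact ⟨⟨s ^ m, m, rfl⟩, hm⟩

variable {B τ : Type u} [CommRing B] [SetLike τ B] [AddSubgroupClass τ B] {ℬ : ℕ → τ} [GradedRing ℬ]

/-- **The kernel of `(A_s)₀ → (B_{g s})₀` is `(ker g)_{(s)}`** for a graded ring homomorphism
`g : A → B`. [folklore] -/
theorem ker_awayMap_eq (g : 𝒜 →+*ᵍ ℬ) :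
    RingHom.ker (Away.map g s) = awayIdeal 𝒜 hs (RingHom.ker g) := by
  refine le_antisymm ?_ (Ideal.span_le.mpr ?_)
  · intro x hx
    obtain ⟨n, a, ha, rfl⟩ := Away.mk_surjective 𝒜 hs x
    rw [RingHom.mem_ker, Away.map_mk, Away.mk_eq_zero_iff] at hx
    obtain ⟨m, hm⟩ := hx
    rw [Away.mk_eq_mk_pow_mul 𝒜 hs n m a ha]
    refine mk_mem_awayIdeal 𝒜 hs _ ?_
    rw [RingHom.mem_ker, map_mul, map_pow]
    exact hm
  · rintro _ ⟨n, a, ha, haI, rfl⟩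
    rw [SetLike.mem_coe, RingHom.mem_ker, Away.map_mk, Away.mk_eq_zero_iff]
    exact ⟨0, by rw [pow_zero, one_mul]; exact haI⟩

/-- Products of the generating fractions: `(a/sⁿ)(b/sᵐ) = ab/s^{n+m}`. [folklore] -/
theorem Away.mk_mul_mk (n m : ℕ) (a b : A) (ha : a ∈ 𝒜 (n • d)) (hb : b ∈ 𝒜 (m • d)) :
    Away.mk 𝒜 hs n a ha * Away.mk 𝒜 hs m b hb = Away.mk 𝒜 hs (n + m) (a * b)
      (by rw [add_smul]; exact SetLike.mul_mem_graded ha hb) := by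
  apply val_injective
  rw [HomogeneousLocalization.val_mul]
  simp only [Away.val_mk, Localization.mk_mul]
  congr 1
  exact Subtype.ext (pow_add s n m).symm

/-- Sums of generating fractions with the same denominator. [folklore] -/
theorem Away.mk_add_mk (n : ℕ) (a b : A) (ha : a ∈ 𝒜 (n • d)) (hb : b ∈ 𝒜 (n • d)) :
    Away.mk 𝒜 hs n a ha + Away.mk 𝒜 hs n b hb = Away.mk 𝒜 hs n (a + b) (add_mem ha hb) := by
  apply val_injective
  rw [HomogeneousLocalization.val_add]
  simp only [Away.val_mk, Localization.add_mk_self]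

/-- `0/sⁿ = 0`. [folklore] -/
theorem Away.mk_zero (n : ℕ) : Away.mk 𝒜 hs n 0 (zero_mem _) = 0 := by
  apply val_injective
  simp only [Away.val_mk, Localization.mk_zero, HomogeneousLocalization.val_zero]

/-! ### Charts of degree one: dehomogenized generators -/

/-- `a / sⁿ` for `a ∈ 𝒜 n` and `deg s = 1`. [folklore] -/
def mk₁ (hs : s ∈ 𝒜 1) (n : ℕ) (a : A) (ha : a ∈ 𝒜 n) : Away 𝒜 s :=
  Away.mk 𝒜 hs n a (by rwa [smul_eq_mul, mul_one])

/-- The value of `a/sⁿ` in the localization `A_s`. [folklore] -/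
theorem val_mk₁ (hs : s ∈ 𝒜 1) (n : ℕ) (a : A) (ha : a ∈ 𝒜 n) :
    (mk₁ 𝒜 hs n a ha).val = Localization.mk a (⟨s ^ n, n, rfl⟩ : Submonoid.powers s) := by
  simp [mk₁, Away.val_mk]

/-- Congruence in the numerator. [folklore] -/
theorem mk₁_congr (hs : s ∈ 𝒜 1) {n : ℕ} {a b : A} (h : a = b) (ha : a ∈ 𝒜 n) (hb : b ∈ 𝒜 n) :
    mk₁ 𝒜 hs n a ha = mk₁ 𝒜 hs n b hb := by
  subst h; rfl

/-- `0/sⁿ = 0`. [folklore] -/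
theorem mk₁_zero (hs : s ∈ 𝒜 1) (n : ℕ) (h0 : (0 : A) ∈ 𝒜 n) : mk₁ 𝒜 hs n 0 h0 = 0 := by
  apply val_injective
  rw [val_mk₁, Localization.mk_zero, HomogeneousLocalization.val_zero]

/-- Additivity in the numerator. [folklore] -/
theorem mk₁_add (hs : s ∈ 𝒜 1) (n : ℕ) (a b : A) (ha : a ∈ 𝒜 n) (hb : b ∈ 𝒜 n) :
    mk₁ 𝒜 hs n (a + b) (add_mem ha hb) = mk₁ 𝒜 hs n a ha + mk₁ 𝒜 hs n b hb := by
  apply val_injective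
  rw [HomogeneousLocalization.val_add, val_mk₁, val_mk₁, val_mk₁, Localization.add_mk_self]

/-- Finite sums in the numerator. [folklore] -/
theorem mk₁_sum (hs : s ∈ 𝒜 1) (n : ℕ) {κ : Type*} (t : Finset κ) (a : κ → A)
    (ha : ∀ k, a k ∈ 𝒜 n) :
    mk₁ 𝒜 hs n (∑ k ∈ t, a k) (sum_mem fun k _ => ha k) = ∑ k ∈ t, mk₁ 𝒜 hs n (a k) (ha k) := by
  classical
  have h0 : (0 : A) ∈ 𝒜 n := zero_mem _
  induction t using Finset.induction_on with
  | empty =>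
    exact (mk₁_congr 𝒜 hs Finset.sum_empty _ h0).trans (by rw [Finset.sum_empty]; exact mk₁_zero 𝒜 hs n _)
  | insert k t hk ih =>
    conv_rhs => rw [Finset.sum_insert hk]
    rw [← ih, ← mk₁_add]
    exact mk₁_congr 𝒜 hs (Finset.sum_insert hk) _ _

/-- `(c b)/sᵐ = (c/sⁱ)(b/s^{m-i})` for `c ∈ 𝒜_i`, `i ≤ m`. [folklore] -/
theorem mk₁_mul (hs : s ∈ 𝒜 1) {i m : ℕ} (him : i ≤ m) (c b : A) (hc : c ∈ 𝒜 i) (hb : b ∈ 𝒜 (m - i)) :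
    mk₁ 𝒜 hs m (c * b) (by simpa [Nat.add_sub_cancel' him] using SetLike.mul_mem_graded hc hb) =
      mk₁ 𝒜 hs i c hc * mk₁ 𝒜 hs (m - i) b hb := by
  apply val_injective
  rw [HomogeneousLocalization.val_mul, val_mk₁, val_mk₁, val_mk₁, Localization.mk_mul]
  congr 1
  exact Subtype.ext (by change s ^ m = s ^ i * s ^ (m - i); rw [← pow_add, Nat.add_sub_cancel' him])

/-- **Dehomogenized generators**: over a chart `D₊(s)` with `deg s = 1`, if `I` is generated by forms
`z_l` of degrees `N_l`, then `I_{(s)}` is generated by the `z_l / s^{N_l}`.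
[cite: Hartshorne1977, II Prop. 5.11 (proof)] -/
theorem awayIdeal_span_eq (hs : s ∈ 𝒜 1) {ι' : Type*} (z : ι' → A) (N : ι' → ℕ)
    (hz : ∀ l, z l ∈ 𝒜 (N l)) :
    awayIdeal 𝒜 hs (Ideal.span (Set.range z)) =
      Ideal.span (Set.range fun l => mk₁ 𝒜 hs (N l) (z l) (hz l)) := by
  classical
  set K := Ideal.span (Set.range fun l => mk₁ 𝒜 hs (N l) (z l) (hz l)) with hK
  refine le_antisymm (Ideal.span_le.mpr ?_) (Ideal.span_le.mpr ?_)
  · rintro _ ⟨n, a, ha, haI, rfl⟩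
    -- every homogeneous component of every element of `(z_l)` gives an element of `K`
    have key : ∀ a ∈ Ideal.span (Set.range z), ∀ m : ℕ,
        mk₁ 𝒜 hs m (DirectSum.decompose 𝒜 a m) (SetLike.coe_mem _) ∈ K := by
      intro a haI
      refine Submodule.span_induction ?_ ?_ ?_ ?_ haI
      · rintro _ ⟨l, rfl⟩ m
        by_cases hm : N l = m
        · subst hm
          rw [mk₁_congr 𝒜 hs (DirectSum.decompose_of_mem_same 𝒜 (hz l)) _ (hz l)]
          exact Ideal.subset_span ⟨l, rfl⟩
        · rw [mk₁_congr 𝒜 hs (DirectSum.decompose_of_mem_ne 𝒜 (hz l) hm) _ (zero_mem _), mk₁_zero]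
          exact K.zero_mem
      · intro m
        rw [mk₁_congr 𝒜 hs (by rw [DirectSum.decompose_zero]; rfl) _ (zero_mem _), mk₁_zero]
        exact K.zero_mem
      · intro a b _ _ iha ihb m
        rw [mk₁_congr 𝒜 hs (by rw [DirectSum.decompose_add]; rfl) _
          (add_mem (SetLike.coe_mem _) (SetLike.coe_mem _)),
          mk₁_add 𝒜 hs m _ _ (SetLike.coe_mem _) (SetLike.coe_mem _)]
        exact K.add_mem (iha m) (ihb m)
      · intro c a _ iha m
        rw [smul_eq_mul]
        -- `c = Σᵢ cᵢ`, `(cᵢ a)_m = cᵢ a_{m-i}` for `i ≤ m`, else `0`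
        have hc : c * a = ∑ i ∈ (DirectSum.decompose 𝒜 c).support,
            (DirectSum.decompose 𝒜 c i : A) * a := by
          rw [← Finset.sum_mul, DirectSum.sum_support_decompose 𝒜 c]
        have hterm : ∀ i, (DirectSum.decompose 𝒜 ((DirectSum.decompose 𝒜 c i : A) * a) m : A) ∈ 𝒜 m :=
          fun i => SetLike.coe_mem _
        have hsum : (DirectSum.decompose 𝒜 (c * a) m : A) =
            ∑ i ∈ (DirectSum.decompose 𝒜 c).support,
              (DirectSum.decompose 𝒜 ((DirectSum.decompose 𝒜 c i : A) * a) m : A) := by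
          have := congrArg (GradedRing.proj 𝒜 m) hc
          rw [map_sum] at this
          simpa only [GradedRing.proj_apply] using this
        rw [mk₁_congr 𝒜 hs hsum _ (sum_mem fun i _ => hterm i), mk₁_sum 𝒜 hs m _ _ hterm]
        refine K.sum_mem fun i _ => ?_
        by_cases him : i ≤ m
        · rw [mk₁_congr 𝒜 hs (DirectSum.coe_decompose_mul_of_left_mem_of_le 𝒜 (SetLike.coe_mem _) him)
            _ (by simpa [Nat.add_sub_cancel' him] using
              SetLike.mul_mem_graded (SetLike.coe_mem (DirectSum.decompose 𝒜 c i)) (SetLike.coe_mem (DirectSum.decompose 𝒜 a (m - i)))),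
            mk₁_mul 𝒜 hs him _ _ (SetLike.coe_mem _) (SetLike.coe_mem _)]
          exact K.mul_mem_left _ (iha (m - i))
        · rw [mk₁_congr 𝒜 hs (DirectSum.coe_decompose_mul_of_left_mem_of_not_le 𝒜 (SetLike.coe_mem _) him)
            _ (zero_mem _), mk₁_zero]
          exact K.zero_mem
    have hmem := key a haI n
    have han : a ∈ 𝒜 n := by rwa [smul_eq_mul, mul_one] at ha
    rw [mk₁_congr 𝒜 hs (DirectSum.decompose_of_mem_same 𝒜 han) _ han] at hmem
    exact hmem
  · rintro _ ⟨l, rfl⟩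
    exact mk_mem_awayIdeal 𝒜 hs _ (Ideal.subset_span ⟨l, rfl⟩)

end Algebra

/-! ## Sections of the kernel ideal sheaf of `Proj g` over the charts `D₊(s)` -/

section ProjMap

variable {A σ : Type u} [CommRing A] [SetLike σ A] [AddSubgroupClass σ A]
  {𝒜 : ℕ → σ} [GradedRing 𝒜]
  {B τ : Type u} [CommRing B] [SetLike τ B] [AddSubgroupClass τ B] {ℬ : ℕ → τ} [GradedRing ℬ]
  (g : 𝒜 →+*ᵍ ℬ) (hg : HomogeneousIdeal.irrelevant ℬ ≤ (HomogeneousIdeal.irrelevant 𝒜).map g)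

/-- On sections over `D₊(s)`, `Proj g` is `(A_s)₀ → (B_{g s})₀` (Mathlib
`Proj.awayToSection_comp_appLE`, elementwise). [folklore] -/
theorem projMap_app_awayToSection {i : ℕ} {s : A} (hs : s ∈ 𝒜 i) (x : Away 𝒜 s) :
    ((Proj.map g hg).app (Proj.basicOpen 𝒜 s)).hom ((Proj.awayToSection 𝒜 s).hom x) =
      (Proj.awayToSection ℬ (g s)).hom (Away.map g s x) := by
  have h := congrArg (fun φ => φ.hom x) (Proj.awayToSection_comp_appLE g hg hs)
  simp only [CommRingCat.hom_comp, RingHom.comp_apply, CommRingCat.hom_ofHom] at h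
  rw [Scheme.Hom.app_eq_appLE]
  exact h

include hg in
/-- **Sections of the kernel ideal sheaf of `Proj g` over a chart.** For a surjective graded ring
homomorphism `g : A → B` (so `Proj g : Proj B → Proj A` is a closed immersion) and `s ∈ 𝒜_i`,
`i > 0`, the ideal of sections over `D₊(s)` of the kernel ideal sheaf of `Proj g` is
`(ker g)_{(s)}`, through `Γ(Proj A, D₊(s)) ≅ (A_s)₀`. [cite: Hartshorne1977, II Prop. 5.9, Ex. 3.12] -/
theorem ker_projMap_ideal_basicOpen (hsurj : Function.Surjective g) {i : ℕ} (hi : 0 < i) {s : A}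
    (hs : s ∈ 𝒜 i) :
    (Proj.map g hg).ker.ideal ⟨Proj.basicOpen 𝒜 s, Proj.isAffineOpen_basicOpen 𝒜 s hs hi⟩ =
      (awayIdeal 𝒜 hs (RingHom.ker g)).map (Proj.awayToSection 𝒜 s).hom := by
  haveI : IsClosedImmersion (Proj.map g hg) := Literature.AlgebraicGeometry.FundamentalGroup.isClosedImmersion_projMap_of_surjective g hg hsurj
  rw [Scheme.Hom.ker_apply, ← ker_awayMap_eq 𝒜 hs g]
  have hinjB : Function.Injective (Proj.awayToSection ℬ (g s)).hom :=
    (ConcreteCategory.bijective_of_isIso (Proj.basicOpenIsoAway ℬ (g s) (g.2 hs) hi).hom).1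
  have hbijA : Function.Bijective (Proj.awayToSection 𝒜 s).hom :=
    ConcreteCategory.bijective_of_isIso (Proj.basicOpenIsoAway 𝒜 s hs hi).hom
  ext t
  obtain ⟨x, rfl⟩ := hbijA.2 t
  change (Proj.awayToSection 𝒜 s).hom x ∈ RingHom.ker ((Proj.map g hg).app (Proj.basicOpen 𝒜 s)).hom ↔ _
  rw [RingHom.mem_ker, projMap_app_awayToSection g hg hs,
    Ideal.mem_map_iff_of_surjective _ hbijA.2]
  constructor
  · intro h
    refine ⟨x, ?_, rfl⟩
    rw [RingHom.mem_ker]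
    apply hinjB
    exact h.trans (map_zero _).symm
  · rintro ⟨x', hx', hxx'⟩
    obtain rfl := hbijA.1 hxx'
    rw [RingHom.mem_ker] at hx'
    exact (congrArg _ hx').trans (map_zero _)

end ProjMap

/-! ## The ideal sheaf `Ĩ` of a homogeneous ideal -/

section HomogeneousIdeal

open Literature.RingTheory.GradedAlgebra

variable {R A : Type u} [CommRing R] [CommRing A] [Algebra R A] (𝒜 : ℕ → Submodule R A)
  [GradedAlgebra 𝒜]

/-- **The ideal sheaf `Ĩ ≤ 𝒪_{Proj A}` of a homogeneous ideal `I ≤ A`**, defined as the kernel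
ideal sheaf of the closed immersion `Proj (A ⧸ I) → Proj A` (`Proj` of the graded quotient map).
[cite: Hartshorne1977, II Prop. 5.9] -/
def projIdealSheaf (I : HomogeneousIdeal 𝒜) : (Proj 𝒜).IdealSheafData :=
  (Proj.map (quotGradedHom 𝒜 I.toIdeal) (irrelevant_quotGrading_le_map 𝒜 I)).ker

omit [GradedAlgebra 𝒜] in
/-- The kernel of the graded quotient map is `I`. [folklore] -/
theorem ker_quotGradedHom (I : Ideal A) :
    RingHom.ker (quotGradedHom 𝒜 I) = I := by
  ext a
  rw [RingHom.mem_ker]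
  change quotGradedHom 𝒜 I a = 0 ↔ a ∈ I
  rw [quotGradedHom_apply, Ideal.Quotient.eq_zero_iff_mem]

/-- **`Ĩ(D₊(s)) = I_{(s)}`**: over the chart `D₊(s)` (`s ∈ 𝒜_i`, `i > 0`) the ideal sheaf of the
homogeneous ideal `I` consists of the fractions with numerators in `I`, through
`Γ(Proj A, D₊(s)) ≅ (A_s)₀`. [cite: Hartshorne1977, II Prop. 5.11 (b) (proof)] -/
theorem projIdealSheaf_ideal_basicOpen (I : HomogeneousIdeal 𝒜) {i : ℕ} (hi : 0 < i) {s : A}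
    (hs : s ∈ 𝒜 i) :
    (projIdealSheaf 𝒜 I).ideal ⟨Proj.basicOpen 𝒜 s, Proj.isAffineOpen_basicOpen 𝒜 s hs hi⟩ =
      (awayIdeal 𝒜 hs I.toIdeal).map (Proj.awayToSection 𝒜 s).hom := by
  rw [projIdealSheaf, ker_projMap_ideal_basicOpen _ _ (quotGradedHom_surjective 𝒜 I.toIdeal) hi hs,
    ker_quotGradedHom]

/-- The same over a chart `D₊(s)` of degree one for an ideal generated by forms `z_l` of degrees
`N_l`: `Ĩ(D₊(s))` is generated by the dehomogenized forms `z_l / s^{N_l}`.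
[cite: Hartshorne1977, II Prop. 5.11 (b) (proof)] -/
theorem projIdealSheaf_ideal_basicOpen_span {ι' : Type*} (z : ι' → A) (N : ι' → ℕ)
    (hz : ∀ l, z l ∈ 𝒜 (N l)) (hI : (Ideal.span (Set.range z)).IsHomogeneous 𝒜) {s : A}
    (hs : s ∈ 𝒜 1) :
    (projIdealSheaf 𝒜 ⟨Ideal.span (Set.range z), hI⟩).ideal
        ⟨Proj.basicOpen 𝒜 s, Proj.isAffineOpen_basicOpen 𝒜 s hs one_pos⟩ =
      Ideal.span (Set.range fun l => (Proj.awayToSection 𝒜 s).hom (mk₁ 𝒜 hs (N l) (z l) (hz l))) := by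
  rw [projIdealSheaf_ideal_basicOpen 𝒜 _ one_pos hs]
  change (awayIdeal 𝒜 hs (Ideal.span (Set.range z))).map _ = _
  rw [awayIdeal_span_eq 𝒜 hs z N hz, Ideal.map_span, ← Set.range_comp]
  rfl

/-- An ideal generated by homogeneous elements is homogeneous (Mathlib
`Ideal.homogeneous_span`). [folklore] -/
theorem isHomogeneous_span_of_forall_mem {ι' : Type*} (z : ι' → A) (N : ι' → ℕ)
    (hz : ∀ l, z l ∈ 𝒜 (N l)) : (Ideal.span (Set.range z)).IsHomogeneous 𝒜 :=
  Ideal.homogeneous_span 𝒜 _ fun _ ⟨l, hl⟩ => hl ▸ ⟨N l, hz l⟩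

end HomogeneousIdeal

end Literature.AlgebraicGeometry.Resolution

end
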